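import Summits.KontsevichZagierPeriods.KontsevichZagierPeriods.Theorems.CommonUnfoldingInterchangeLemma

/-!
# Weighted signed couplings (route CommonUnfolding, crux `PeakNormalForm`, rung `k × l` interchange)

Helper lemmas for the `k × l` interchange (`CommonUnfoldingPeakNormalFormKlInterchange.lean`,
stub `stub_klInterchange` of stmt-KontsevichZagierPeriods-4828): DATA-LEVEL generalisations of the
two halves of the floor's proof (`CommonUnfoldingInterchangeLemma.lean`, stmt-4830), with RATIONAL
WEIGHTS `p q : ℚ` and the base integrand `G` decoupled from the fibre increments `g₁`, `g₃` (in the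
floor `g₁ = g₃ = G`).

* `of_sub_of_mem_newtonLeibnizRel_of_weightedCoupling` (weighted descent): the coupling
  `R = p·f₁h₃ + q·h₁f₃ − pq·G h₁h₃` on the double band (`hᵢ = 1/(βᵢ − αᵢ)`) descends by ONE
  Newton–Leibniz instance to any `c` on `b₁`'s band with integrand `p·f₁ + q·h₁g₃ − pq·h₁G`
  (the `s`-primitive is `p f₁ (s − α₃) h₃ + q h₁ F₃ − pq G h₁ h₃ (s − α₃)`);
* `exists_weightedCoupling` (weighted peak): such an `R` exists as a `KZ.IntegralRep (n + 2)`
  (`ℚ`-semialgebraic; absolutely integrable by Tonelli along the last coordinate, the middle term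
  transported through the coordinate swap) together with the two one-level-down pieces `c`, `c'`
  on the bands (integrable since `∫_band |h · (g ∘ init)| = ‖g‖₁`).

Weights must be `ℚ`-semialgebraic constants, hence rational. No definitions are introduced.
Proof found by seat fwd-rung-KontsevichZagierPeriods-03 (`Rung_birth.lean`, stubs A/B).

References: M. Kontsevich, D. Zagier, *Periods* (2001), §1.2, rule 3); signed couplings with
prescribed marginals (Fréchet classes) are standard.
-/

namespace Summit.KontsevichZagierPeriods.CommonUnfolding

open Set MeasureTheory
open Literature.NumberTheory.Transcendental
open Literature.ModelTheory.ExponentialFields (IsSemialgebraic)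

/-- **Weighted descent.** On the double band `{(x, t, s) | (x, t) ∈ b₁.domain, α₃ x ≤ s ≤ β₃ x}`
the weighted signed coupling `R = p·f₁ h₃ + q·h₁ f₃ − p q·G h₁ h₃` (`hᵢ = 1/(βᵢ − αᵢ)`, `F₃` an
`s`-primitive of `f₃` with increment `g₃`) descends by one Newton–Leibniz move to any
representation `c` on `b₁.domain` with integrand `p·f₁ + q·h₁ g₃ − p q·h₁ G`: the primitive
`p f₁ (s − α₃) h₃ + q h₁ F₃ − p q G h₁ h₃ (s − α₃)` is `ℚ`-semialgebraic, continuous on the closed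
fibres, and differentiates to `R` on the open ones. Generalises
`of_sub_of_mem_newtonLeibnizRel_of_coupling` (`p = q = 1`, `g₃ = G`, `c = b₁`).
[Kontsevich–Zagier 2001, §1.2 rule 3)] [folklore] -/
theorem of_sub_of_mem_newtonLeibnizRel_of_weightedCoupling {n : ℕ} (τ : Set (Fin n → ℝ))
    (α₁ β₁ α₃ β₃ G g₃ : (Fin n → ℝ) → ℝ) (F₃ : (Fin (n + 1) → ℝ) → ℝ)
    (b₁ b₃ : KZ.IntegralRep (n + 1)) (R : KZ.IntegralRep (n + 2)) (c : KZ.IntegralRep (n + 1))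
    (p q : ℚ)
    (hα₁ : IsSemialgebraicFunOn ℚ τ α₁) (hβ₁ : IsSemialgebraicFunOn ℚ τ β₁)
    (hα₃ : IsSemialgebraicFunOn ℚ τ α₃) (hβ₃ : IsSemialgebraicFunOn ℚ τ β₃)
    (hG : IsSemialgebraicFunOn ℚ τ G)
    (hlt₁ : ∀ x ∈ τ, α₁ x < β₁ x) (hlt₃ : ∀ x ∈ τ, α₃ x < β₃ x)
    (hd₁ : b₁.domain = KZlog.band τ α₁ β₁) (hd₃ : b₃.domain = KZlog.band τ α₃ β₃)
    (hF₃ : IsSemialgebraicFunOn ℚ b₃.domain F₃)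
    (hcont₃ : ∀ x ∈ τ, ContinuousOn (fun t : ℝ => F₃ (Fin.snoc x t)) (Icc (α₃ x) (β₃ x)))
    (hder₃ : ∀ x ∈ τ, ∀ t ∈ Ioo (α₃ x) (β₃ x),
      HasDerivAt (fun s : ℝ => F₃ (Fin.snoc x s)) (b₃.integrand (Fin.snoc x t)) t)
    (hbase₃ : ∀ x ∈ τ, g₃ x = F₃ (Fin.snoc x (β₃ x)) - F₃ (Fin.snoc x (α₃ x)))
    (hRd : R.domain =
      KZlog.band (KZlog.band τ α₁ β₁) (fun z => α₃ (Fin.init z)) (fun z => β₃ (Fin.init z)))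
    (hRi : ∀ w ∈ R.domain, R.integrand w =
      (p : ℝ) * (b₁.integrand (Fin.init w) *
        (β₃ (Fin.init (Fin.init w)) - α₃ (Fin.init (Fin.init w)))⁻¹) +
      (q : ℝ) * (b₃.integrand (Fin.snoc (Fin.init (Fin.init w)) (w (Fin.last (n + 1)))) *
        (β₁ (Fin.init (Fin.init w)) - α₁ (Fin.init (Fin.init w)))⁻¹) -
      (p : ℝ) * (q : ℝ) * (G (Fin.init (Fin.init w)) *
        (β₁ (Fin.init (Fin.init w)) - α₁ (Fin.init (Fin.init w)))⁻¹ *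
        (β₃ (Fin.init (Fin.init w)) - α₃ (Fin.init (Fin.init w)))⁻¹))
    (hcd : c.domain = b₁.domain)
    (hci : ∀ z ∈ b₁.domain, c.integrand z =
      (p : ℝ) * b₁.integrand z +
      (q : ℝ) * (g₃ (Fin.init z) * (β₁ (Fin.init z) - α₁ (Fin.init z))⁻¹) -
      (p : ℝ) * (q : ℝ) * (G (Fin.init z) * (β₁ (Fin.init z) - α₁ (Fin.init z))⁻¹)) :
    KZ.of R - KZ.of c ∈ KZ.newtonLeibnizRel := by
  have hRsa := R.isSemialgebraic_domain
  obtain ⟨-, hα₃'', hc₁, hc₃, hG'', hF₃'⟩ :=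
    coupling_pieces hα₁ hβ₁ hα₃ hβ₃ hG hlt₁ hlt₃ (hd₃ ▸ hF₃) hRd
  have hB₁τ : ∀ z ∈ b₁.domain, Fin.init z ∈ τ := fun z hz => by
    rw [hd₁] at hz
    exact hz.1
  have hRB₁ : R.domain ⊆ {w | Fin.init w ∈ b₁.domain} := by
    rw [hRd, hd₁]
    exact KZ.band_subset_setOf_init_mem
  have hf₁' : IsSemialgebraicFunOn ℚ R.domain fun w => b₁.integrand (Fin.init w) :=
    b₁.isSemialgebraicFunOn_integrand.comp_init.mono hRB₁ hRsa
  have hs : IsSemialgebraicFunOn ℚ R.domain fun w => w (Fin.last (n + 1)) :=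
    isSemialgebraicFunOn_apply hRsa _
  have hp : IsSemialgebraicFunOn ℚ R.domain fun _ => (p : ℝ) := isSemialgebraicFunOn_ratCast hRsa p
  have hq : IsSemialgebraicFunOn ℚ R.domain fun _ => (q : ℝ) := isSemialgebraicFunOn_ratCast hRsa q
  -- the `s`-primitive and its semialgebraicity
  have hGsa : IsSemialgebraicFunOn ℚ R.domain fun w =>
      (p : ℝ) * (b₁.integrand (Fin.init w) * (w (Fin.last (n + 1)) - α₃ (Fin.init (Fin.init w))) *
          (β₃ (Fin.init (Fin.init w)) - α₃ (Fin.init (Fin.init w)))⁻¹) +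
        (q : ℝ) * ((β₁ (Fin.init (Fin.init w)) - α₁ (Fin.init (Fin.init w)))⁻¹ *
          F₃ (Fin.snoc (Fin.init (Fin.init w)) (w (Fin.last (n + 1))))) -
        (p : ℝ) * (q : ℝ) * (G (Fin.init (Fin.init w)) *
          (β₁ (Fin.init (Fin.init w)) - α₁ (Fin.init (Fin.init w)))⁻¹ *
          (β₃ (Fin.init (Fin.init w)) - α₃ (Fin.init (Fin.init w)))⁻¹ *
          (w (Fin.last (n + 1)) - α₃ (Fin.init (Fin.init w)))) :=
    IsSemialgebraicFunOn.sub_holds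
      (IsSemialgebraicFunOn.add_holds
        (IsSemialgebraicFunOn.mul_holds hp
          (IsSemialgebraicFunOn.mul_holds
            (IsSemialgebraicFunOn.mul_holds hf₁' (IsSemialgebraicFunOn.sub_holds hs hα₃'')) hc₃))
        (IsSemialgebraicFunOn.mul_holds hq (IsSemialgebraicFunOn.mul_holds hc₁ hF₃')))
      (IsSemialgebraicFunOn.mul_holds (IsSemialgebraicFunOn.mul_holds hp hq)
        (IsSemialgebraicFunOn.mul_holds
          (IsSemialgebraicFunOn.mul_holds (IsSemialgebraicFunOn.mul_holds hG'' hc₁) hc₃)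
          (IsSemialgebraicFunOn.sub_holds hs hα₃'')))
  refine ⟨n + 1, R, c, fun z => α₃ (Fin.init z), fun z => β₃ (Fin.init z), _, hGsa,
    ?_, ?_, ?_, ?_, ?_, ?_, ?_, rfl⟩
  · rw [hcd]; exact hα₃.comp_init.mono hB₁τ b₁.isSemialgebraic_domain
  · rw [hcd]; exact hβ₃.comp_init.mono hB₁τ b₁.isSemialgebraic_domain
  · intro z hz
    rw [hcd] at hz
    exact (hlt₃ _ (hB₁τ z hz)).le
  · rw [hcd, hRd, hd₁]; rfl
  · -- continuity of the primitive on the closed fibre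
    intro z hz
    rw [hcd] at hz
    have hx := hB₁τ z hz
    simp only [Fin.init_snoc, Fin.snoc_last]
    exact (((continuousOn_const.mul ((continuousOn_const.mul
      (continuousOn_id.sub continuousOn_const)).mul continuousOn_const)).add
      (continuousOn_const.mul (continuousOn_const.mul (hcont₃ _ hx)))).sub
      (continuousOn_const.mul (continuousOn_const.mul (continuousOn_id.sub continuousOn_const))))
  · -- its derivative along the open fibre is the weighted coupling
    intro z hz t ht
    rw [hcd] at hz
    have hx := hB₁τ z hz
    have hzt : (Fin.snoc z t : Fin (n + 2) → ℝ) ∈ R.domain := by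
      rw [hRd, KZlog.snoc_mem_band, ← hd₁]
      exact ⟨hz, Ioo_subset_Icc_self ht⟩
    rw [hRi _ hzt]
    simp only [Fin.init_snoc, Fin.snoc_last]
    refine ((((((hasDerivAt_id' t).sub_const _).const_mul _).mul_const _).const_mul _).add
      (((hder₃ _ hx t ht).const_mul _).const_mul _)).sub
      ((((hasDerivAt_id' t).sub_const _).const_mul _).const_mul _) |>.congr_deriv ?_
    ring
  · -- its increment over the fibre is `c`'s integrand
    intro z hz
    rw [hcd] at hz
    have hx := hB₁τ z hz
    have h1 : β₁ (Fin.init z) - α₁ (Fin.init z) ≠ 0 := (sub_pos.2 (hlt₁ _ hx)).ne'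
    have h3 : β₃ (Fin.init z) - α₃ (Fin.init z) ≠ 0 := (sub_pos.2 (hlt₃ _ hx)).ne'
    simp only [Fin.init_snoc, Fin.snoc_last]
    rw [hci z hz, hbase₃ _ hx]
    field_simp
    ring

/-- **Weighted peak.** For two bands over the same `ℚ`-semialgebraic base `τ` with nondegenerate
fibres `[α₁, β₁]`, `[α₃, β₃]`, rational weights `p q`, and `ℚ`-semialgebraic integrable base data
`G g₁ g₃`, the weighted signed coupling `R = p·f₁ h₃ + q·h₁ f₃ − p q·G h₁ h₃` is a
`KZ.IntegralRep (n + 2)` on the double band (absolute integrability by Tonelli along the last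
coordinate, `integrableOn_band_div_width`; the middle term through the measure-preserving swap of the
last two coordinates), and the two one-level-down pieces `c = [b₁.domain, p f₁ + q h₁ g₃ − p q h₁ G]`,
`c' = [b₃.domain, q f₃ + p h₃ g₁ − q p h₃ G]` are `KZ.IntegralRep (n + 1)`s. Generalises the
packaging half of `interchangeLemma_proof`. [Kontsevich–Zagier 2001, §1.2; Tonelli] [folklore] -/
theorem exists_weightedCoupling {n : ℕ} (τ : Set (Fin n → ℝ))
    (α₁ β₁ α₃ β₃ G g₁ g₃ : (Fin n → ℝ) → ℝ) (b₁ b₃ : KZ.IntegralRep (n + 1)) (p q : ℚ)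
    (hτ : IsSemialgebraic ℚ τ)
    (hα₁ : IsSemialgebraicFunOn ℚ τ α₁) (hβ₁ : IsSemialgebraicFunOn ℚ τ β₁)
    (hα₃ : IsSemialgebraicFunOn ℚ τ α₃) (hβ₃ : IsSemialgebraicFunOn ℚ τ β₃)
    (hG : IsSemialgebraicFunOn ℚ τ G) (hg₁ : IsSemialgebraicFunOn ℚ τ g₁)
    (hg₃ : IsSemialgebraicFunOn ℚ τ g₃)
    (hGi : IntegrableOn G τ) (hg₁i : IntegrableOn g₁ τ) (hg₃i : IntegrableOn g₃ τ)
    (hlt₁ : ∀ x ∈ τ, α₁ x < β₁ x) (hlt₃ : ∀ x ∈ τ, α₃ x < β₃ x)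
    (hd₁ : b₁.domain = KZlog.band τ α₁ β₁) (hd₃ : b₃.domain = KZlog.band τ α₃ β₃) :
    ∃ (R : KZ.IntegralRep (n + 2)) (c c' : KZ.IntegralRep (n + 1)),
      R.domain =
        KZlog.band (KZlog.band τ α₁ β₁) (fun z => α₃ (Fin.init z)) (fun z => β₃ (Fin.init z)) ∧
      (∀ w ∈ R.domain, R.integrand w =
        (p : ℝ) * (b₁.integrand (Fin.init w) *
          (β₃ (Fin.init (Fin.init w)) - α₃ (Fin.init (Fin.init w)))⁻¹) +
        (q : ℝ) * (b₃.integrand (Fin.snoc (Fin.init (Fin.init w)) (w (Fin.last (n + 1)))) *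
          (β₁ (Fin.init (Fin.init w)) - α₁ (Fin.init (Fin.init w)))⁻¹) -
        (p : ℝ) * (q : ℝ) * (G (Fin.init (Fin.init w)) *
          (β₁ (Fin.init (Fin.init w)) - α₁ (Fin.init (Fin.init w)))⁻¹ *
          (β₃ (Fin.init (Fin.init w)) - α₃ (Fin.init (Fin.init w)))⁻¹)) ∧
      c.domain = b₁.domain ∧
      (∀ z ∈ b₁.domain, c.integrand z =
        (p : ℝ) * b₁.integrand z +
        (q : ℝ) * (g₃ (Fin.init z) * (β₁ (Fin.init z) - α₁ (Fin.init z))⁻¹) -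
        (p : ℝ) * (q : ℝ) * (G (Fin.init z) * (β₁ (Fin.init z) - α₁ (Fin.init z))⁻¹)) ∧
      c'.domain = b₃.domain ∧
      (∀ z ∈ b₃.domain, c'.integrand z =
        (q : ℝ) * b₃.integrand z +
        (p : ℝ) * (g₁ (Fin.init z) * (β₃ (Fin.init z) - α₃ (Fin.init z))⁻¹) -
        (q : ℝ) * (p : ℝ) * (G (Fin.init z) * (β₃ (Fin.init z) - α₃ (Fin.init z))⁻¹)) := by
  have hB₁sa : IsSemialgebraic ℚ (KZlog.band τ α₁ β₁) := KZlog.isSemialgebraic_band hα₁ hβ₁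
  have hB₃sa : IsSemialgebraic ℚ (KZlog.band τ α₃ β₃) := KZlog.isSemialgebraic_band hα₃ hβ₃
  have hf₁sa : IsSemialgebraicFunOn ℚ (KZlog.band τ α₁ β₁) b₁.integrand :=
    hd₁ ▸ b₁.isSemialgebraicFunOn_integrand
  have hf₃sa : IsSemialgebraicFunOn ℚ (KZlog.band τ α₃ β₃) b₃.integrand :=
    hd₃ ▸ b₃.isSemialgebraicFunOn_integrand
  have hf₁i : IntegrableOn b₁.integrand (KZlog.band τ α₁ β₁) := hd₁ ▸ b₁.integrableOn
  have hf₃i : IntegrableOn b₃.integrand (KZlog.band τ α₃ β₃) := hd₃ ▸ b₃.integrableOn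
  -- semialgebraic bookkeeping on the double band `D` and on its swap `D'`
  obtain ⟨hDsa, -, hc₁, hc₃, hG'', hf₃''⟩ :=
    coupling_pieces hα₁ hβ₁ hα₃ hβ₃ hG hlt₁ hlt₃ hf₃sa rfl
  obtain ⟨hD'sa, -, -, hc₁', -, -⟩ :=
    coupling_pieces hα₃ hβ₃ hα₁ hβ₁ hG hlt₃ hlt₁ hf₁sa rfl
  have hα₃' : IsSemialgebraicFunOn ℚ (KZlog.band τ α₁ β₁) fun z => α₃ (Fin.init z) :=
    hα₃.comp_init_mono hB₁sa KZ.band_subset_setOf_init_mem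
  have hβ₃' : IsSemialgebraicFunOn ℚ (KZlog.band τ α₁ β₁) fun z => β₃ (Fin.init z) :=
    hβ₃.comp_init_mono hB₁sa KZ.band_subset_setOf_init_mem
  have hα₁' : IsSemialgebraicFunOn ℚ (KZlog.band τ α₃ β₃) fun z => α₁ (Fin.init z) :=
    hα₁.comp_init_mono hB₃sa KZ.band_subset_setOf_init_mem
  have hβ₁' : IsSemialgebraicFunOn ℚ (KZlog.band τ α₃ β₃) fun z => β₁ (Fin.init z) :=
    hβ₁.comp_init_mono hB₃sa KZ.band_subset_setOf_init_mem
  have hlt₃' : ∀ z ∈ KZlog.band τ α₁ β₁, α₃ (Fin.init z) < β₃ (Fin.init z) :=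
    fun z hz => hlt₃ _ hz.1
  have hlt₁' : ∀ z ∈ KZlog.band τ α₃ β₃, α₁ (Fin.init z) < β₁ (Fin.init z) :=
    fun z hz => hlt₁ _ hz.1
  -- inverse widths on the two bands
  have hw₁ : IsSemialgebraicFunOn ℚ (KZlog.band τ α₁ β₁) fun z =>
      (β₁ (Fin.init z) - α₁ (Fin.init z))⁻¹ :=
    (IsSemialgebraicFunOn.sub_holds (hβ₁.comp_init_mono hB₁sa KZ.band_subset_setOf_init_mem)
      (hα₁.comp_init_mono hB₁sa KZ.band_subset_setOf_init_mem)).inv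
      fun z hz => (sub_pos.2 (hlt₁ _ hz.1)).ne'
  have hw₃ : IsSemialgebraicFunOn ℚ (KZlog.band τ α₃ β₃) fun z =>
      (β₃ (Fin.init z) - α₃ (Fin.init z))⁻¹ :=
    (IsSemialgebraicFunOn.sub_holds (hβ₃.comp_init_mono hB₃sa KZ.band_subset_setOf_init_mem)
      (hα₃.comp_init_mono hB₃sa KZ.band_subset_setOf_init_mem)).inv
      fun z hz => (sub_pos.2 (hlt₃ _ hz.1)).ne'
  -- integrability of the three pieces of the coupling (Tonelli along the last coordinate)
  have hT₁ : IntegrableOn (fun w : Fin (n + 2) → ℝ => b₁.integrand (Fin.init w) *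
      (β₃ (Fin.init (Fin.init w)) - α₃ (Fin.init (Fin.init w)))⁻¹)
      (KZlog.band (KZlog.band τ α₁ β₁) (fun z => α₃ (Fin.init z))
        (fun z => β₃ (Fin.init z))) :=
    integrableOn_band_div_width hB₁sa hα₃' hβ₃' hlt₃' hf₁sa hf₁i
  have hφsa : IsSemialgebraicFunOn ℚ (KZlog.band τ α₁ β₁) fun z =>
      G (Fin.init z) * (β₁ (Fin.init z) - α₁ (Fin.init z))⁻¹ :=
    IsSemialgebraicFunOn.mul_holds (hG.comp_init_mono hB₁sa KZ.band_subset_setOf_init_mem) hw₁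
  have hT₃ : IntegrableOn (fun w : Fin (n + 2) → ℝ => G (Fin.init (Fin.init w)) *
      (β₁ (Fin.init (Fin.init w)) - α₁ (Fin.init (Fin.init w)))⁻¹ *
      (β₃ (Fin.init (Fin.init w)) - α₃ (Fin.init (Fin.init w)))⁻¹)
      (KZlog.band (KZlog.band τ α₁ β₁) (fun z => α₃ (Fin.init z))
        (fun z => β₃ (Fin.init z))) :=
    integrableOn_band_div_width hB₁sa hα₃' hβ₃' hlt₃' hφsa
      (integrableOn_band_div_width hτ hα₁ hβ₁ hlt₁ hG hGi)
  have hT₂'sa : IsSemialgebraicFunOn ℚ (KZlog.band (KZlog.band τ α₃ β₃)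
      (fun z => α₁ (Fin.init z)) (fun z => β₁ (Fin.init z))) fun w =>
      b₃.integrand (Fin.init w) * (β₁ (Fin.init (Fin.init w)) - α₁ (Fin.init (Fin.init w)))⁻¹ :=
    IsSemialgebraicFunOn.mul_holds (hf₃sa.comp_init_mono hD'sa KZ.band_subset_setOf_init_mem) hc₁'
  have hT₂ : IntegrableOn (fun w : Fin (n + 2) → ℝ =>
      b₃.integrand (Fin.snoc (Fin.init (Fin.init w)) (w (Fin.last (n + 1)))) *
        (β₁ (Fin.init (Fin.init w)) - α₁ (Fin.init (Fin.init w)))⁻¹)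
      (KZlog.band (KZlog.band τ α₁ β₁) (fun z => α₃ (Fin.init z))
        (fun z => β₃ (Fin.init z))) := by
    have hQ : IntegrableOn (fun w : Fin (n + 2) → ℝ => (fun w' : Fin (n + 2) → ℝ =>
        b₃.integrand (Fin.init w') * (β₁ (Fin.init (Fin.init w')) - α₁ (Fin.init (Fin.init w')))⁻¹)
          (fun i => w (Equiv.swap (Fin.castSucc (Fin.last n)) (Fin.last (n + 1)) i)))
        {w | (fun i => w (Equiv.swap (Fin.castSucc (Fin.last n)) (Fin.last (n + 1)) i)) ∈
          KZlog.band (KZlog.band τ α₃ β₃) (fun z => α₁ (Fin.init z))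
            (fun z => β₁ (Fin.init z))} :=
      (KZ.IntegralRep.reindex ⟨_, _, hD'sa, hT₂'sa,
        integrableOn_band_div_width hB₃sa hα₁' hβ₁' hlt₁' hf₃sa hf₃i⟩
        (Equiv.swap (Fin.castSucc (Fin.last n)) (Fin.last (n + 1)))).integrableOn
    rw [setOf_comp_swap_mem_dband] at hQ
    refine hQ.congr_fun (fun w _ => ?_) hDsa.measurableSet_holds
    simp only [KZ.init_comp_swap, Fin.init_snoc]
  -- the weighted peak
  have hpD : IsSemialgebraicFunOn ℚ (KZlog.band (KZlog.band τ α₁ β₁) (fun z => α₃ (Fin.init z))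
      (fun z => β₃ (Fin.init z))) fun _ => (p : ℝ) := isSemialgebraicFunOn_ratCast hDsa p
  have hqD : IsSemialgebraicFunOn ℚ (KZlog.band (KZlog.band τ α₁ β₁) (fun z => α₃ (Fin.init z))
      (fun z => β₃ (Fin.init z))) fun _ => (q : ℝ) := isSemialgebraicFunOn_ratCast hDsa q
  have hRsa : IsSemialgebraicFunOn ℚ (KZlog.band (KZlog.band τ α₁ β₁)
      (fun z => α₃ (Fin.init z)) (fun z => β₃ (Fin.init z))) fun w =>
      (p : ℝ) * (b₁.integrand (Fin.init w) *
        (β₃ (Fin.init (Fin.init w)) - α₃ (Fin.init (Fin.init w)))⁻¹) +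
      (q : ℝ) * (b₃.integrand (Fin.snoc (Fin.init (Fin.init w)) (w (Fin.last (n + 1)))) *
        (β₁ (Fin.init (Fin.init w)) - α₁ (Fin.init (Fin.init w)))⁻¹) -
      (p : ℝ) * (q : ℝ) * (G (Fin.init (Fin.init w)) *
        (β₁ (Fin.init (Fin.init w)) - α₁ (Fin.init (Fin.init w)))⁻¹ *
        (β₃ (Fin.init (Fin.init w)) - α₃ (Fin.init (Fin.init w)))⁻¹) :=
    IsSemialgebraicFunOn.sub_holds
      (IsSemialgebraicFunOn.add_holds
        (IsSemialgebraicFunOn.mul_holds hpD (IsSemialgebraicFunOn.mul_holds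
          (hf₁sa.comp_init_mono hDsa KZ.band_subset_setOf_init_mem) hc₃))
        (IsSemialgebraicFunOn.mul_holds hqD (IsSemialgebraicFunOn.mul_holds hf₃'' hc₁)))
      (IsSemialgebraicFunOn.mul_holds (IsSemialgebraicFunOn.mul_holds hpD hqD)
        (IsSemialgebraicFunOn.mul_holds (IsSemialgebraicFunOn.mul_holds hG'' hc₁) hc₃))
  let R : KZ.IntegralRep (n + 2) := ⟨_, _, hDsa, hRsa,
    ((hT₁.const_mul (p : ℝ)).add (hT₂.const_mul (q : ℝ))).sub (hT₃.const_mul ((p : ℝ) * (q : ℝ)))⟩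
  -- the two one-level-down pieces
  have hcsa : IsSemialgebraicFunOn ℚ (KZlog.band τ α₁ β₁) fun z =>
      (p : ℝ) * b₁.integrand z +
      (q : ℝ) * (g₃ (Fin.init z) * (β₁ (Fin.init z) - α₁ (Fin.init z))⁻¹) -
      (p : ℝ) * (q : ℝ) * (G (Fin.init z) * (β₁ (Fin.init z) - α₁ (Fin.init z))⁻¹) :=
    IsSemialgebraicFunOn.sub_holds
      (IsSemialgebraicFunOn.add_holds
        (IsSemialgebraicFunOn.mul_holds (isSemialgebraicFunOn_ratCast hB₁sa p) hf₁sa)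
        (IsSemialgebraicFunOn.mul_holds (isSemialgebraicFunOn_ratCast hB₁sa q)
          (IsSemialgebraicFunOn.mul_holds (hg₃.comp_init_mono hB₁sa KZ.band_subset_setOf_init_mem)
            hw₁)))
      (IsSemialgebraicFunOn.mul_holds
        (IsSemialgebraicFunOn.mul_holds (isSemialgebraicFunOn_ratCast hB₁sa p)
          (isSemialgebraicFunOn_ratCast hB₁sa q)) hφsa)
  have hci : IntegrableOn (fun z =>
      (p : ℝ) * b₁.integrand z +
      (q : ℝ) * (g₃ (Fin.init z) * (β₁ (Fin.init z) - α₁ (Fin.init z))⁻¹) -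
      (p : ℝ) * (q : ℝ) * (G (Fin.init z) * (β₁ (Fin.init z) - α₁ (Fin.init z))⁻¹))
      (KZlog.band τ α₁ β₁) :=
    ((hf₁i.const_mul (p : ℝ)).add
      ((integrableOn_band_div_width hτ hα₁ hβ₁ hlt₁ hg₃ hg₃i).const_mul (q : ℝ))).sub
      ((integrableOn_band_div_width hτ hα₁ hβ₁ hlt₁ hG hGi).const_mul ((p : ℝ) * (q : ℝ)))
  let c : KZ.IntegralRep (n + 1) := ⟨_, _, hB₁sa, hcsa, hci⟩
  have hφsa' : IsSemialgebraicFunOn ℚ (KZlog.band τ α₃ β₃) fun z =>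
      G (Fin.init z) * (β₃ (Fin.init z) - α₃ (Fin.init z))⁻¹ :=
    IsSemialgebraicFunOn.mul_holds (hG.comp_init_mono hB₃sa KZ.band_subset_setOf_init_mem) hw₃
  have hc'sa : IsSemialgebraicFunOn ℚ (KZlog.band τ α₃ β₃) fun z =>
      (q : ℝ) * b₃.integrand z +
      (p : ℝ) * (g₁ (Fin.init z) * (β₃ (Fin.init z) - α₃ (Fin.init z))⁻¹) -
      (q : ℝ) * (p : ℝ) * (G (Fin.init z) * (β₃ (Fin.init z) - α₃ (Fin.init z))⁻¹) :=
    IsSemialgebraicFunOn.sub_holds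
      (IsSemialgebraicFunOn.add_holds
        (IsSemialgebraicFunOn.mul_holds (isSemialgebraicFunOn_ratCast hB₃sa q) hf₃sa)
        (IsSemialgebraicFunOn.mul_holds (isSemialgebraicFunOn_ratCast hB₃sa p)
          (IsSemialgebraicFunOn.mul_holds (hg₁.comp_init_mono hB₃sa KZ.band_subset_setOf_init_mem)
            hw₃)))
      (IsSemialgebraicFunOn.mul_holds
        (IsSemialgebraicFunOn.mul_holds (isSemialgebraicFunOn_ratCast hB₃sa q)
          (isSemialgebraicFunOn_ratCast hB₃sa p)) hφsa')
  have hc'i : IntegrableOn (fun z =>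
      (q : ℝ) * b₃.integrand z +
      (p : ℝ) * (g₁ (Fin.init z) * (β₃ (Fin.init z) - α₃ (Fin.init z))⁻¹) -
      (q : ℝ) * (p : ℝ) * (G (Fin.init z) * (β₃ (Fin.init z) - α₃ (Fin.init z))⁻¹))
      (KZlog.band τ α₃ β₃) :=
    ((hf₃i.const_mul (q : ℝ)).add
      ((integrableOn_band_div_width hτ hα₃ hβ₃ hlt₃ hg₁ hg₁i).const_mul (p : ℝ))).sub
      ((integrableOn_band_div_width hτ hα₃ hβ₃ hlt₃ hG hGi).const_mul ((q : ℝ) * (p : ℝ)))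
  let c' : KZ.IntegralRep (n + 1) := ⟨_, _, hB₃sa, hc'sa, hc'i⟩
  exact ⟨R, c, c', rfl, fun w _ => rfl, hd₁.symm, fun z _ => rfl, hd₃.symm, fun z _ => rfl⟩

end Summit.KontsevichZagierPeriods.CommonUnfolding
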